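import Summits.FinalStateConjecture.FinalStateConjecture.Theorems.EIHFluxBalanceInertialRecessionStubMomCapstoneJetLipschitz

/-!
# Route EIHFluxBalance — `InertialRecession` (E′), line `SketchCleanExcision`, skeleton r13,
# stub `stub_momCapstone` (A): the POINTWISE momentum-row estimate on jet space

Helper file for the crux `stmt-FinalStateConjecture-17403`
(`Summit.FinalStateConjecture.FinalStateConjecture.Theses.EIHFluxBalance.InertialRecession`, E′),
registered stub `stub_momCapstone` (A) of skeleton r13; continuation of
`…StubMomCapstoneJetAffine` / `…StubMomCapstoneJetLipschitz`. Given the two halves of the registered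
momentum-row lemma `stub_momRowLinear` (ML, HYPOTHESES here), this file proves the heart of the stub
as a statement about two symmetric `2`-jets `(B, D, DD)` (the jet of the vacuum lab metric `e + g₀`
at a tube point, whose Ricci jet function vanishes) and `(B₀, D₀, DD₀)` (the jet of the frozen ansatz
`g₀`, with coercive bounded value and jet-free SLICE data):

* `momCap_jet_pointwise` — **if the two jets are `δ`-close, `δ = δ(m, α, C_sp, ε)`, then the momentum
  rows of the second satisfy `|ricciJet (0, B₀, D₀, DD₀) (B₀⁻¹dx⁰) e_j| ≤ ε l` for every `l ≥ 1`
  bounding its first jet and its mixed second jet.** The bound is LINEAR in `l`: the slice parts of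
  the two jets are `δ`-close inside a compact set (slice-Lipschitz estimate
  `momCap_jet_sliceLipschitz`, constant `(1 + 2l)L`), and the normal parts differ by `δ` at a base jet
  whose rows vanish (ML(ii) on jet space, `momCap_jetML₂`, constant `C(1 + ‖D‖)`).

No definitions, no named facts, no `sorry`.
-/

set_option linter.dupNamespace false
set_option maxSynthPendingDepth 6
set_option synthInstance.maxHeartbeats 200000

noncomputable section

namespace Summit.FinalStateConjecture.FinalStateConjecture.Theorems.SublinearIsFree.Slaving

open scoped BigOperators Topology ContDiff
open Filter Set Function Metric Literature.Geometry.Lorentzian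
  Literature.Geometry.Lorentzian.MetricCoord
open Summit.FinalStateConjecture.FinalStateConjecture.Theorems

/-! ### The pointwise estimate on jet space -/

/-- The space of `2`-jets of metric components on `E4` (local notation). -/
local notation "Jet₂" => E4 × (E4 →L[ℝ] E4 →L[ℝ] ℝ) × (E4 →L[ℝ] E4 →L[ℝ] E4 →L[ℝ] ℝ) ×
  (E4 →L[ℝ] E4 →L[ℝ] E4 →L[ℝ] E4 →L[ℝ] ℝ)

/-- `|v⁰| ≤ ‖v‖` on `E4`, i.e. `‖dx⁰‖ ≤ 1`. [folklore] -/
theorem momCap_norm_dx_zero_le : ‖E4.dx 0‖ ≤ 1 := by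
  refine ContinuousLinearMap.opNorm_le_bound _ zero_le_one fun v ↦ ?_
  have hv : (E4.dx 0) v = v 0 := rfl
  rw [one_mul, Real.norm_eq_abs, hv]
  refine abs_le_of_sq_le_sq ?_ (norm_nonneg v)
  rw [norm_sq_eq_sq_add_spatialNorm_sq v]
  nlinarith [sq_nonneg (E4.spatialNorm v)]

set_option maxHeartbeats 3200000 in
/-- **The pointwise momentum-row estimate on jet space.** Let the two halves of the registered
momentum-row lemma `stub_momRowLinear` hold (hypotheses `hML₁`, `hML₂`). For sizes `m > 0`, `α`,
`C_sp ≥ 0` and `ε > 0` there is `δ > 0` such that for two symmetric `2`-jets `(B, D, DD)` (invertible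
value, vanishing Ricci jet function — the jet of a vacuum metric) and `(B₀, D₀, DD₀)` (value
`m/2`-coercive of norm `≤ α`, SLICE data bounded by `C_sp`: `‖D₀w‖ ≤ C_sp‖w‖`,
`‖DD₀(w)(w')‖ ≤ C_sp‖w‖‖w'‖` for spatial `w, w'`) which are `δ`-close, and every `l ≥ 1` with
`‖D₀‖ ≤ l`, `‖DD₀(w)‖ ≤ l‖w‖` for spatial `w`: the momentum rows of the second jet satisfy
`|ricciJet (0, B₀, D₀, DD₀) (B₀⁻¹dx⁰) e_j| ≤ ε l` (`j = 1, 2, 3`).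
Proof: split both jets into slice parts `J, J₀` and normal parts along `dx⁰` (`momCap_decomp₁/₂`);
by ML(ii) on jet space (`momCap_jetML₂`, base jet `(B, D, DD)`, whose rows vanish, perturbed by the
difference `≤ δ` of the normal parts) the rows of `J + ι(ν₀)` are `≤ 6Cδ l`; by the slice-Lipschitz
estimate (`momCap_jet_sliceLipschitz`, `J₀` in the compact set `{0} × {m/2-coercive, ‖·‖ ≤ α} × B̄(0,C_sp)²`,
`‖J − J₀‖ ≤ δ`, `‖ν₀‖ ≤ l`) the rows of `J + ι(ν₀)` and of `J₀ + ι(ν₀) = (0, B₀, D₀, DD₀)` differ by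
`≤ 3Lδ l`. [folklore] -/
theorem momCap_jet_pointwise
    (hML₁ : ∀ {G G₁ G₂ G₃ : E4 → E4 →L[ℝ] E4 →L[ℝ] ℝ} {V : Set E4} {x : E4} {n : E4 →L[ℝ] ℝ} {A₁ A₂ : E4 →L[ℝ] E4 →L[ℝ] ℝ} {P₁ P₂ : E4 →L[ℝ] E4 →L[ℝ] E4 →L[ℝ] ℝ} {W₁ W₂ W₃ : E4 →L[ℝ] E4 →L[ℝ] ℝ} (c₁ c₂ : ℝ), MetricCoord.IsMetricOn G V → MetricCoord.IsMetricOn G₁ V → MetricCoord.IsMetricOn G₂ V → MetricCoord.IsMetricOn G₃ V → x ∈ V → G₁ x = G x → G₂ x = G x → G₃ x = G x → fderiv ℝ G₁ x = fderiv ℝ G x + n.smulRight A₁ → fderiv ℝ G₂ x = fderiv ℝ G x + n.smulRight A₂ → fderiv ℝ G₃ x = fderiv ℝ G x + n.smulRight (c₁ • A₁ + c₂ • A₂) → (∀ v, fderiv ℝ (fderiv ℝ G₁) x v = fderiv ℝ (fderiv ℝ G) x v + (n v • P₁ + n.smulRight (P₁ v) + n v • n.smulRight W₁)) → (∀ v,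 fderiv ℝ (fderiv ℝ G₂) x v = fderiv ℝ (fderiv ℝ G) x v + (n v • P₂ + n.smulRight (P₂ v) + n v • n.smulRight W₂)) → (∀ v, fderiv ℝ (fderiv ℝ G₃) x v = fderiv ℝ (fderiv ℝ G) x v + (n v • (c₁ • P₁ + c₂ • P₂) + n.smulRight ((c₁ • P₁ + c₂ • P₂) v) + n v • n.smulRight W₃)) → ∀ e : E4, n e = 0 → MetricCoord.ricAt G₃ x (MetricCoord.sharpAt G x n) e - MetricCoord.ricAt G x (MetricCoord.sharpAt G x n) e = c₁ * (MetricCoord.ricAt G₁ x (MetricCoord.sharpAt G x n) e - MetricCoord.ricAt G x (MetricCoord.sharpAt G x n) e) + c₂ * (MetricCoord.ricAt G₂ x (MetricCoord.sharpAt G x n) e - MetricCoord.ricAt G x (MetricCoord.sharpAt G x n) e))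
    (hML₂ : ∀ μ ν : ℝ, 0 < μ → ∃ C : ℝ, ∀ {G G₁ : E4 → E4 →L[ℝ] E4 →L[ℝ] ℝ} {V : Set E4} {x : E4} {n : E4 →L[ℝ] ℝ} {A : E4 →L[ℝ] E4 →L[ℝ] ℝ} {P : E4 →L[ℝ] E4 →L[ℝ] E4 →L[ℝ] ℝ} {W : E4 →L[ℝ] E4 →L[ℝ] ℝ}, MetricCoord.IsMetricOn G V → MetricCoord.IsMetricOn G₁ V → x ∈ V → (∀ v : E4, μ * ‖v‖ ≤ ‖G x v‖) → ‖G x‖ ≤ ν → G₁ x = G x → fderiv ℝ G₁ x = fderiv ℝ G x + n.smulRight A → (∀ v, fderiv ℝ (fderiv ℝ G₁) x v = fderiv ℝ (fderiv ℝ G) x v + (n v • P + n.smulRight (P v) + n v • n.smulRight W)) → ∀ e : E4, n e = 0 → |MetricCoord.ricAt G₁ x (MetricCoord.sharpAt G x n) e - MetricCoord.ricAt G x (MetricCoord.sharpAt G x n) e| ≤ C * (1 + ‖fderiv ℝ G x‖) * (‖A‖ + ‖P‖) * ‖n‖ ^ 2 * ‖e‖)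
    {m α Csp ε : ℝ} (hm : 0 < m) (hCsp : 0 ≤ Csp) (hε : 0 < ε) :
    ∃ δ : ℝ, 0 < δ ∧ ∀ {B B₀ : E4 →L[ℝ] E4 →L[ℝ] ℝ} {D D₀ : E4 →L[ℝ] E4 →L[ℝ] E4 →L[ℝ] ℝ}
      {DD DD₀ : E4 →L[ℝ] E4 →L[ℝ] E4 →L[ℝ] E4 →L[ℝ] ℝ},
      (∀ v w, B v w = B w v) → B.IsInvertible → (∀ z v w, D z v w = D z w v) →
      (∀ z z' v w, DD z z' v w = DD z z' w v) → (∀ v w, DD v w = DD w v) →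
      (∀ v w, B₀ v w = B₀ w v) → B₀.IsInvertible → (∀ z v w, D₀ z v w = D₀ z w v) →
      (∀ z z' v w, DD₀ z z' v w = DD₀ z z' w v) → (∀ v w, DD₀ v w = DD₀ w v) →
      ricciJet (((0 : E4), B, D, DD) : Jet₂) = 0 →
      (∀ v : E4, m / 2 * ‖v‖ ≤ ‖B₀ v‖) → ‖B₀‖ ≤ α →
      (∀ w : E4, w 0 = 0 → ‖D₀ w‖ ≤ Csp * ‖w‖) →
      (∀ w w' : E4, w 0 = 0 → w' 0 = 0 → ‖DD₀ w w'‖ ≤ Csp * ‖w‖ * ‖w'‖) →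
      ‖B - B₀‖ ≤ δ → ‖D - D₀‖ ≤ δ → ‖DD - DD₀‖ ≤ δ →
      ∀ l : ℝ, 1 ≤ l → ‖D₀‖ ≤ l → (∀ w : E4, w 0 = 0 → ‖DD₀ w‖ ≤ l * ‖w‖) →
      ∀ j : Fin 3, |ricciJet (((0 : E4), B₀, D₀, DD₀) : Jet₂) (B₀.inverse (E4.dx 0))
        (E4.basisVector j.succ)| ≤ ε * l := by
  -- the compact set of slice jets
  set KA : Set (E4 →L[ℝ] E4 →L[ℝ] ℝ) := {A | ‖A‖ ≤ α ∧ ∀ v : E4, m / 2 * ‖v‖ ≤ ‖A v‖} with hKA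
  set K : Set Jet₂ := ({(0 : E4)} : Set E4) ×ˢ (KA ×ˢ
    (closedBall (0 : E4 →L[ℝ] E4 →L[ℝ] E4 →L[ℝ] ℝ) Csp ×ˢ
      closedBall (0 : E4 →L[ℝ] E4 →L[ℝ] E4 →L[ℝ] E4 →L[ℝ] ℝ) Csp)) with hK
  haveI i1 : FiniteDimensional ℝ (E4 →L[ℝ] E4 →L[ℝ] ℝ) := inferInstance
  haveI i2 : FiniteDimensional ℝ (E4 →L[ℝ] E4 →L[ℝ] E4 →L[ℝ] ℝ) := inferInstance
  haveI i3 : FiniteDimensional ℝ (E4 →L[ℝ] E4 →L[ℝ] E4 →L[ℝ] E4 →L[ℝ] ℝ) := inferInstance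
  haveI : ProperSpace (E4 →L[ℝ] E4 →L[ℝ] E4 →L[ℝ] ℝ) := FiniteDimensional.proper_real _
  haveI : ProperSpace (E4 →L[ℝ] E4 →L[ℝ] E4 →L[ℝ] E4 →L[ℝ] ℝ) := FiniteDimensional.proper_real _
  have hKc : IsCompact K :=
    isCompact_singleton.prod ((isCompact_coerciveBox α (m / 2)).prod
      ((isCompact_closedBall _ _).prod (isCompact_closedBall _ _)))
  have hKΩ : K ⊆ {j : Jet₂ | j.2.1.IsInvertible} :=
    fun j hj ↦ coerciveBox_subset_isInvertible (by positivity) hj.2.1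
  -- the constants of the two jet-space estimates
  obtain ⟨r, hr, L, hL, hLip⟩ := momCap_jet_sliceLipschitz hML₁ hKc hKΩ (E4.dx 0)
  obtain ⟨C, hC⟩ := momCap_jetML₂ hML₂ (μ := m / 4) (ν := α + 1) (by positivity)
  have hC' : 0 ≤ max C 0 := le_max_right _ _
  -- the smallness threshold
  have hS0 : 0 < 6 * max C 0 + 3 * L + 1 := by positivity
  set δ : ℝ := min (m / 4) (min 1 (min r (ε / (6 * max C 0 + 3 * L + 1)))) with hδ
  have hδ0 : 0 < δ := lt_min (by positivity) (lt_min one_pos (lt_min hr (div_pos hε hS0)))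
  have hδm : δ ≤ m / 4 := min_le_left _ _
  have hδ1 : δ ≤ 1 := (min_le_right _ _).trans (min_le_left _ _)
  have hδr : δ ≤ r := ((min_le_right _ _).trans (min_le_right _ _)).trans (min_le_left _ _)
  have hδε : (6 * max C 0 + 3 * L + 1) * δ ≤ ε := by
    have : δ ≤ ε / (6 * max C 0 + 3 * L + 1) :=
      ((min_le_right _ _).trans (min_le_right _ _)).trans (min_le_right _ _)
    rwa [le_div_iff₀ hS0, mul_comm] at this
  refine ⟨δ, hδ0, fun {B B₀ D D₀ DD DD₀} hBs hBi hDs hDDs hDDc hB₀s hB₀i hD₀s hDD₀s hDD₀c h0 hcoer hα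
    hS1 hS2 hd0 hd1 hd2 l hl hl1 hl2 j ↦ ?_⟩
  -- the projection `π v = v − v⁰ e₀` and the split of jets along `dx⁰`
  generalize hπ : (ContinuousLinearMap.id ℝ E4 - (E4.dx 0).smulRight (E4.basisVector 0)) = π
  have hπ0 : ∀ v : E4, (π v) 0 = 0 := fun v ↦ by rw [← hπ]; simp
  have hπn : ∀ v : E4, ‖π v‖ ≤ ‖v‖ := fun v ↦ by rw [← hπ]; exact momCap_norm_proj_le v
  have hπ1 : ‖π‖ ≤ 1 := by rw [← hπ]; exact momCap_norm_proj_le_one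
  have hdec₁ : ∀ D₁ : E4 →L[ℝ] E4 →L[ℝ] E4 →L[ℝ] ℝ,
      D₁ = D₁.comp π + (E4.dx 0).smulRight (D₁ (E4.basisVector 0)) := fun D₁ ↦ by
    rw [← hπ]; exact momCap_decomp₁ D₁
  have hdec₂ : ∀ D₂ : E4 →L[ℝ] E4 →L[ℝ] E4 →L[ℝ] E4 →L[ℝ] ℝ, (∀ v w, D₂ v w = D₂ w v) → ∀ v,
      D₂ v = (D₂.bilinearComp π π) v + ((E4.dx 0) v • ((D₂ (E4.basisVector 0)).comp π) +
        (E4.dx 0).smulRight (((D₂ (E4.basisVector 0)).comp π) v) +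
        (E4.dx 0) v • (E4.dx 0).smulRight (D₂ (E4.basisVector 0) (E4.basisVector 0))) :=
    fun D₂ hc v ↦ by rw [← hπ]; exact momCap_decomp₂ D₂ hc v
  -- norms of the coordinate data
  have he₀ : ‖E4.basisVector 0‖ = 1 := by simp
  have hej : ‖E4.basisVector j.succ‖ = 1 := by simp
  have hnej : E4.dx 0 (E4.basisVector j.succ) = 0 := by simp [Fin.succ_ne_zero]
  have hn1 : ‖E4.dx 0‖ ^ 2 ≤ 1 := pow_le_one₀ (norm_nonneg _) momCap_norm_dx_zero_le
  have hl0 : 0 ≤ l := zero_le_one.trans hl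
  -- symmetries of the slice jets and of the normal data
  have hSD : ∀ z v w, (D.comp π) z v w = (D.comp π) z w v := fun z v w ↦ hDs (π z) v w
  have hSD₀ : ∀ z v w, (D₀.comp π) z v w = (D₀.comp π) z w v := fun z v w ↦ hD₀s (π z) v w
  have hSDD : ∀ z z' v w, (DD.bilinearComp π π) z z' v w = (DD.bilinearComp π π) z z' w v :=
    fun z z' v w ↦ by simp only [ContinuousLinearMap.bilinearComp_apply]; exact hDDs _ _ v w
  have hSDD₀ : ∀ z z' v w, (DD₀.bilinearComp π π) z z' v w = (DD₀.bilinearComp π π) z z' w v :=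
    fun z z' v w ↦ by simp only [ContinuousLinearMap.bilinearComp_apply]; exact hDD₀s _ _ v w
  have hSDDc : ∀ v w, (DD.bilinearComp π π) v w = (DD.bilinearComp π π) w v := fun v w ↦ by
    simp only [ContinuousLinearMap.bilinearComp_apply]; exact hDDc _ _
  have hSDD₀c : ∀ v w, (DD₀.bilinearComp π π) v w = (DD₀.bilinearComp π π) w v := fun v w ↦ by
    simp only [ContinuousLinearMap.bilinearComp_apply]; exact hDD₀c _ _
  have hA₀s : ∀ v w, D₀ (E4.basisVector 0) v w = D₀ (E4.basisVector 0) w v := hD₀s _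
  have hP₀s : ∀ z v w, ((DD₀ (E4.basisVector 0)).comp π) z v w =
      ((DD₀ (E4.basisVector 0)).comp π) z w v := fun z v w ↦ hDD₀s _ (π z) v w
  have hW₀s : ∀ v w, DD₀ (E4.basisVector 0) (E4.basisVector 0) v w =
      DD₀ (E4.basisVector 0) (E4.basisVector 0) w v := hDD₀s _ _
  -- the slice jet of `(B₀, D₀, DD₀)` lies in `K`
  have hK₁ : ‖D₀.comp π‖ ≤ Csp := by
    refine ContinuousLinearMap.opNorm_le_bound _ hCsp fun v ↦ ?_
    exact (hS1 (π v) (hπ0 v)).trans (mul_le_mul_of_nonneg_left (hπn v) hCsp)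
  have hK₂ : ‖DD₀.bilinearComp π π‖ ≤ Csp := by
    refine ContinuousLinearMap.opNorm_le_bound₂ _ hCsp fun v w ↦ ?_
    rw [ContinuousLinearMap.bilinearComp_apply]
    refine (hS2 (π v) (π w) (hπ0 v) (hπ0 w)).trans ?_
    exact mul_le_mul (mul_le_mul_of_nonneg_left (hπn v) hCsp) (hπn w) (norm_nonneg _)
      (by positivity)
  have hK₀ : (((0 : E4), B₀, D₀.comp π, DD₀.bilinearComp π π) : Jet₂) ∈ K :=
    Set.mk_mem_prod (Set.mem_singleton _) (Set.mk_mem_prod ⟨hα, hcoer⟩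
      (Set.mk_mem_prod (mem_closedBall_zero_iff.2 hK₁) (mem_closedBall_zero_iff.2 hK₂)))
  -- the slice jets are `δ`-close
  have hdist : ‖(((0 : E4), B, D.comp π, DD.bilinearComp π π) : Jet₂) -
      ((0 : E4), B₀, D₀.comp π, DD₀.bilinearComp π π)‖ ≤ δ := by
    simp only [Prod.mk_sub_mk, sub_self, Prod.norm_mk, norm_zero]
    refine max_le hδ0.le (max_le hd0 (max_le ?_ ?_))
    · rw [← ContinuousLinearMap.sub_comp]
      calc ‖(D - D₀).comp π‖ ≤ ‖D - D₀‖ * ‖π‖ := ContinuousLinearMap.opNorm_comp_le _ _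
        _ ≤ δ * 1 := mul_le_mul hd1 hπ1 (norm_nonneg _) hδ0.le
        _ = δ := mul_one δ
    · refine ContinuousLinearMap.opNorm_le_bound₂ _ hδ0.le fun v w ↦ ?_
      have e1 : (DD.bilinearComp π π - DD₀.bilinearComp π π) v w = (DD - DD₀) (π v) (π w) := by
        simp only [sub_apply, ContinuousLinearMap.bilinearComp_apply]
      rw [e1]
      calc ‖(DD - DD₀) (π v) (π w)‖ ≤ ‖DD - DD₀‖ * ‖π v‖ * ‖π w‖ := (DD - DD₀).le_opNorm₂ _ _
        _ ≤ δ * ‖v‖ * ‖w‖ :=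
          mul_le_mul (mul_le_mul hd2 (hπn v) (norm_nonneg _) hδ0.le) (hπn w) (norm_nonneg _)
            (by positivity)
  -- the normal data of `(B₀, D₀, DD₀)` have size `≤ l`
  have hA₀l : ‖D₀ (E4.basisVector 0)‖ ≤ l :=
    (D₀.le_opNorm _).trans (by rw [he₀, mul_one]; exact hl1)
  have hP₀l : ‖(DD₀ (E4.basisVector 0)).comp π‖ ≤ l := by
    refine ContinuousLinearMap.opNorm_le_bound _ hl0 fun v ↦ ?_
    show ‖DD₀ (E4.basisVector 0) (π v)‖ ≤ l * ‖v‖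
    rw [hDD₀c]
    calc ‖DD₀ (π v) (E4.basisVector 0)‖ ≤ ‖DD₀ (π v)‖ * ‖E4.basisVector 0‖ := (DD₀ (π v)).le_opNorm _
      _ ≤ l * ‖π v‖ * 1 := by rw [he₀]; exact mul_le_mul_of_nonneg_right (hl2 (π v) (hπ0 v)) zero_le_one
      _ ≤ l * ‖v‖ := by rw [mul_one]; exact mul_le_mul_of_nonneg_left (hπn v) hl0
  -- the second components: `DD₀ = slice + normal`, and the slice jet of `(B, D, DD)` with the
  -- normal data of `(B₀, D₀, DD₀)` inserted has second component `DD₀ + (DD − DD₀)(π·, π·)`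
  have hD₂J := hdec₂ DD₀ hDD₀c
  have hsplit : ∀ v, (DD.bilinearComp π π) v =
      (DD₀.bilinearComp π π) v + ((DD - DD₀).bilinearComp π π) v := fun v ↦ by
    ext w Y Z
    simp only [add_apply, sub_apply, ContinuousLinearMap.bilinearComp_apply]
    ring
  have hD₂J' : ∀ v, (DD₀ + (DD - DD₀).bilinearComp π π) v = (DD.bilinearComp π π) v +
      ((E4.dx 0) v • ((DD₀ (E4.basisVector 0)).comp π) +
        (E4.dx 0).smulRight (((DD₀ (E4.basisVector 0)).comp π) v) +
        (E4.dx 0) v • (E4.dx 0).smulRight (DD₀ (E4.basisVector 0) (E4.basisVector 0))) := fun v ↦ by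
    rw [add_apply, hsplit v, hD₂J v]
    abel
  -- (1) the slice-Lipschitz estimate between the two slice jets, normal data of `(B₀, D₀, DD₀)`
  have key₂ := hLip hK₀ hBi (hdist.trans hδr) hB₀s hSD₀ hSDD₀ hSDD₀c hBs hSD hSDD hSDDc hA₀s hP₀s hW₀s hA₀l hP₀l
    hD₂J hD₂J' (E4.basisVector j.succ) hej.le hnej
  rw [← hdec₁ D₀] at key₂
  -- (2) ML(ii) at the base jet `(B, D, DD)`, perturbed by the difference of the normal data
  have h1J : D + (E4.dx 0).smulRight (D₀ (E4.basisVector 0) - D (E4.basisVector 0)) =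
      D.comp π + (E4.dx 0).smulRight (D₀ (E4.basisVector 0)) := by
    nth_rw 1 [hdec₁ D]
    ext v Y Z
    simp only [add_apply, sub_apply, ContinuousLinearMap.smulRight_apply, smul_apply, smul_eq_mul]
    ring
  have h2J : ∀ v, (DD₀ + (DD - DD₀).bilinearComp π π) v = DD v +
      ((E4.dx 0) v • (((DD₀ (E4.basisVector 0)).comp π) - ((DD (E4.basisVector 0)).comp π)) +
        (E4.dx 0).smulRight ((((DD₀ (E4.basisVector 0)).comp π) -
          ((DD (E4.basisVector 0)).comp π)) v) +
        (E4.dx 0) v • (E4.dx 0).smulRight (DD₀ (E4.basisVector 0) (E4.basisVector 0) -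
          DD (E4.basisVector 0) (E4.basisVector 0))) := fun v ↦ by
    rw [hD₂J' v, hdec₂ DD hDDc v]
    ext w Y Z
    simp only [add_apply, sub_apply, ContinuousLinearMap.smulRight_apply, smul_apply, smul_eq_mul]
    ring
  have hAs' : ∀ v w, (D₀ (E4.basisVector 0) - D (E4.basisVector 0)) v w =
      (D₀ (E4.basisVector 0) - D (E4.basisVector 0)) w v := fun v w ↦ by
    simp only [sub_apply, hD₀s _ v w, hDs _ v w]
  have hPs' : ∀ z v w, (((DD₀ (E4.basisVector 0)).comp π) - ((DD (E4.basisVector 0)).comp π)) z v w =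
      (((DD₀ (E4.basisVector 0)).comp π) - ((DD (E4.basisVector 0)).comp π)) z w v := fun z v w ↦ by
    simp only [sub_apply, ContinuousLinearMap.coe_comp, Function.comp_apply, hDD₀s _ _ v w,
      hDDs _ _ v w]
  have hWs' : ∀ v w, (DD₀ (E4.basisVector 0) (E4.basisVector 0) - DD (E4.basisVector 0) (E4.basisVector 0)) v w =
      (DD₀ (E4.basisVector 0) (E4.basisVector 0) - DD (E4.basisVector 0) (E4.basisVector 0)) w v :=
    fun v w ↦ by simp only [sub_apply, hDD₀s _ _ v w, hDDs _ _ v w]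
  have hcoerB : ∀ v : E4, m / 4 * ‖v‖ ≤ ‖B v‖ := fun v ↦ by
    have h := coercive_add_of_norm_le hcoer hd0 v
    rw [add_sub_cancel] at h
    have hm4 : m / 4 ≤ m / 2 - δ := by linarith
    exact (mul_le_mul_of_nonneg_right hm4 (norm_nonneg v)).trans h
  have hBα : ‖B‖ ≤ α + 1 := by
    have h : B = B₀ + (B - B₀) := (add_sub_cancel B₀ B).symm
    rw [h]
    exact (norm_add_le _ _).trans (add_le_add hα (hd0.trans hδ1))
  have key₁ := hC hBs hBi hDs hDDs hDDc hAs' hPs' hWs' h2J hcoerB hBα (E4.basisVector j.succ) hnej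
  rw [h1J, h0] at key₁
  simp only [zero_apply, sub_zero] at key₁
  -- sizes in (2)
  have hDl : ‖D‖ ≤ l + 1 := by
    have h : D = D₀ + (D - D₀) := (add_sub_cancel D₀ D).symm
    rw [h]
    exact (norm_add_le _ _).trans (add_le_add hl1 (hd1.trans hδ1))
  have hA' : ‖D₀ (E4.basisVector 0) - D (E4.basisVector 0)‖ ≤ δ := by
    rw [← sub_apply]
    exact ((D₀ - D).le_opNorm _).trans (by rw [he₀, mul_one, norm_sub_rev]; exact hd1)
  have hP' : ‖((DD₀ (E4.basisVector 0)).comp π) - ((DD (E4.basisVector 0)).comp π)‖ ≤ δ := by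
    refine ContinuousLinearMap.opNorm_le_bound _ hδ0.le fun v ↦ ?_
    have e1 : (((DD₀ (E4.basisVector 0)).comp π) - ((DD (E4.basisVector 0)).comp π)) v =
        (DD₀ - DD) (E4.basisVector 0) (π v) := by
      simp only [sub_apply, ContinuousLinearMap.coe_comp, Function.comp_apply]
    rw [e1]
    calc ‖(DD₀ - DD) (E4.basisVector 0) (π v)‖
        ≤ ‖DD₀ - DD‖ * ‖E4.basisVector 0‖ * ‖π v‖ := (DD₀ - DD).le_opNorm₂ _ _
      _ ≤ δ * 1 * ‖v‖ := by
          rw [he₀, norm_sub_rev]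
          exact mul_le_mul (by rw [mul_one, mul_one]; exact hd2) (hπn v) (norm_nonneg _) (by positivity)
      _ = δ * ‖v‖ := by ring
  -- assemble
  have hT' : |ricciJet (((0 : E4), B, D.comp π + (E4.dx 0).smulRight (D₀ (E4.basisVector 0)),
      DD₀ + (DD - DD₀).bilinearComp π π) : Jet₂) (B.inverse (E4.dx 0)) (E4.basisVector j.succ)| ≤
      6 * max C 0 * l * δ := by
    refine key₁.trans ?_
    have hX : 0 ≤ (1 + ‖D‖) * (‖D₀ (E4.basisVector 0) - D (E4.basisVector 0)‖ +
        ‖((DD₀ (E4.basisVector 0)).comp π) - ((DD (E4.basisVector 0)).comp π)‖) *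
        ‖E4.dx 0‖ ^ 2 * ‖E4.basisVector j.succ‖ := by positivity
    calc C * (1 + ‖D‖) * (‖D₀ (E4.basisVector 0) - D (E4.basisVector 0)‖ +
          ‖((DD₀ (E4.basisVector 0)).comp π) - ((DD (E4.basisVector 0)).comp π)‖) *
          ‖E4.dx 0‖ ^ 2 * ‖E4.basisVector j.succ‖
        = C * ((1 + ‖D‖) * (‖D₀ (E4.basisVector 0) - D (E4.basisVector 0)‖ +
          ‖((DD₀ (E4.basisVector 0)).comp π) - ((DD (E4.basisVector 0)).comp π)‖) *
          ‖E4.dx 0‖ ^ 2 * ‖E4.basisVector j.succ‖) := by ring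
      _ ≤ max C 0 * ((1 + (l + 1)) * (δ + δ) * 1 * 1) := by
          refine mul_le_mul (le_max_left _ _) ?_ hX hC'
          rw [hej]
          gcongr
      _ = max C 0 * δ * (4 + 2 * l) := by ring
      _ ≤ max C 0 * δ * (6 * l) :=
          mul_le_mul_of_nonneg_left (by linarith) (mul_nonneg hC' hδ0.le)
      _ = 6 * max C 0 * l * δ := by ring
  have hdiff := key₂.trans (mul_le_mul_of_nonneg_left hdist (by positivity))
  have hfin : |ricciJet (((0 : E4), B₀, D₀, DD₀) : Jet₂) (B₀.inverse (E4.dx 0)) (E4.basisVector j.succ)| ≤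
      6 * max C 0 * l * δ + (1 + 2 * l) * L * δ := by
    have habs : ∀ a b : ℝ, |a| ≤ |b| + |b - a| := fun a b ↦ by
      calc |a| = |b - (b - a)| := by ring_nf
        _ ≤ |b| + |b - a| := abs_sub _ _
    exact (habs _ _).trans (add_le_add hT' hdiff)
  refine hfin.trans ?_
  have h3 : (1 + 2 * l) * L * δ ≤ 3 * l * L * δ := by
    have : (1 + 2 * l) ≤ 3 * l := by linarith
    exact mul_le_mul_of_nonneg_right (mul_le_mul_of_nonneg_right this hL) hδ0.le
  calc 6 * max C 0 * l * δ + (1 + 2 * l) * L * δ ≤ 6 * max C 0 * l * δ + 3 * l * L * δ := by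
        linarith [h3]
    _ = l * ((6 * max C 0 + 3 * L) * δ) := by ring
    _ ≤ l * ((6 * max C 0 + 3 * L + 1) * δ) :=
        mul_le_mul_of_nonneg_left (mul_le_mul_of_nonneg_right (by linarith) hδ0.le) hl0
    _ ≤ l * ε := mul_le_mul_of_nonneg_left hδε hl0
    _ = ε * l := mul_comm _ _

/-- **Registered one-line carrier form** (`momCap_norm_dx_zero_le_sA`) of `momCap_norm_dx_zero_le`:
`‖dx⁰‖ ≤ 1` on `E4`. [folklore] -/
theorem momCap_norm_dx_zero_le_sA : open Literature.Geometry.Lorentzian in ‖E4.dx 0‖ ≤ 1 :=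
  momCap_norm_dx_zero_le

end Summit.FinalStateConjecture.FinalStateConjecture.Theorems.SublinearIsFree.Slaving

end
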